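import Summits.BirchSwinnertonDyer.BirchSwinnertonDyer.Theses.QuadraticBranchSignedControl
import HarnessLib

/-!
# Route `QuadraticBranchSignedControl` (rung K8-Gss2, cell `bsd-potss`): the identity glue item
# stmt-BirchSwinnertonDyer-19523 `PublishedInputEntireLFunctionOfNamed` — bookkeeping (the third
# child is definitionally the parent); no mathematics; BSD is not proved by any of this (seat k8q-c5 g2)

HONEST FRAMING (cell `bsd-potss`, run/shared/lean/pub/bsd-potss/): the programme assembles BSD for
analytic-rank `≤ 1` curves strictly from published theorems and TYPES the remainder. This file closes a
staffability glue leaf of the planner's split of the cite-level alias item 19513 (K8 rev 16): the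
three children are BY-NAME aliases of published inputs (never prover targets) and the glue says that
the third child IS the parent. Nothing about any L-function is asserted or proved here.
-/

set_option autoImplicit false
-- the Theorems directory repeats the summit name (sibling precedent `QuadraticBranchSignedControlAssembly.lean`)
set_option linter.dupNamespace false

namespace Summit.BirchSwinnertonDyer.BirchSwinnertonDyer.Theorems

/-- **Glue item 19523** (`PublishedInputGrossZagier73Named → PublishedInputRankEqAnalyticRankNamed →
PublishedInputEntireLFunctionByName → PublishedInputEntireLFunction`): the last child is the parent by
definition (both are the named fact `WeierstrassCurve.hasEntireLFunction_rat` — entire continuation of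
`L(E/ℚ, s)` by modularity, Breuil–Conrad–Diamond–Taylor 2001 Thm. A + Hecke — stated BY NAME; nothing
about it is asserted); the first two children ride along for staffability bookkeeping only. Term
`fun _ _ h ↦ h` (the planner's certified sketch `k8r15/sketch19513.lean`).
[cite: BCDT2001, Thm. A (modularity of every E/ℚ; with Hecke's continuation)] -/
theorem publishedInputEntireLFunctionOfNamed_proof :
    Summit.BirchSwinnertonDyer.BirchSwinnertonDyer.Theses.QuadraticBranchSignedControl.PublishedInputEntireLFunctionOfNamed :=
  fun _ _ h ↦ h

end Summit.BirchSwinnertonDyer.BirchSwinnertonDyer.Theorems
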